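import Summits.QuantumFields.YangMills.Theorems.BalabanUVNodesN16ApproximateSchemeTransferSub
import HarnessLib

/-!
# YM-DAG node N16 (NE3), the located averaging pin (42) ↔ (0.4) — part 29: THE APPROXIMATE TRANSFER PRINCIPLE (III) — PER-STEP ⇒ `k`-FOLD: the depth-`k` defect
# (H1) `ApproxSchemeGaugeEquiv` from ONE-STEP defects up to gauge, under Lipschitz control and FINE gauge covariance of the target scheme; the (43) covariance instance

Cell `pub-ymgap`, width seat `pub-ymgap-dag-n16-w3` (director-ym №197 ∕ HUMAN RULING D-0149), generation 9; part 29 of the W1b lineage, the propagation half of part 27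
(`…N16ApproximateSchemeTransfer`: `CfgNear`; part 27′ `…Sub`: `ApproxSchemeGaugeEquivIn Γ`).  `--supports stmt-QuantumFields-27366 --as helper` (K3⁸, KEY MAP v2; count-neutral).  `bears_on: R4∕N16`.

THE POINT.  Part 27∕27′'s hypothesis (H1) asks the `k`-FOLD averages of two schemes to be `δ_k`-close up to a `Γ`-valued `N`-periodic coarse gauge on the class (`Γ` = the
gauge group: `U(N)`-units in part 27, any subgroup of them in part 27′ — `SU(N)` for the (0.4) side, part 23's (d1)); everything below carries `Γ` as a parameter.  What the lineage
measures (parts 22∕25∕26) is a ONE-STEP discrepancy: the (0.4) step of record vs (42) at the level of bond variables, second order per step.  This file is the bookkeeping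
from one step to `k` steps, with its two analytic inputs displayed:
 * §1 hypothesis SHAPES (asserted for nothing): `StepNear d s₁ s₂ L N k C η` — at step `k+1` (depth `k+1 → k`) the two one-step outputs of every `U ∈ C` are bondwise `η`-close up
   to a unitary `(N·L^k)`-periodic FINE gauge; `LipschitzNear d s k C η₀ Λ` — the `k`-fold `s`-average is `Λ`-Lipschitz for bondwise distances `≤ η₀` from the class (for (43):
   [Balaban1985Averaging] Prop. 1 ∕ (42) on the small-field guard — analysis, NOT proved here); structure `FineGaugeCov d s L N k C r` — the `k`-fold `s`-average is covariant under
   unitary `(N·L^k)`-periodic FINE gauges through a restriction map `r` producing unitary `N`-periodic coarse gauges ([Balaban1985Averaging] (11)∕(45) shape).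
 * §2 ★★★ `approx_succ` — THE INDUCTION STEP: (H1) at depth `k` on `𝒞 k` with defect `δ`, `StepNear` at step `k+1` on `𝒞 (k+1)` with `η ≤ η₀`, `LipschitzNear` (radius `η₀`,
   constant `Λ`) and `FineGaugeCov` for the TARGET scheme `s₂` at depth `k`, `s₁ (k+1)` mapping `𝒞 (k+1)` into `𝒞 k`, `𝒞 k` invariant under unitary `(N·L^k)`-periodic gauges,
   and the two block-lift covariance clauses at depth `k+1` ⇒ (H1) at depth `k+1` on `𝒞 (k+1)` with defect `Λ·η + δ` (the gauges compose: `r κ · κ′`; §1 of part 27 transports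
   the depth-`k` closeness by the unitary `r κ`; triangle).  ★★ `approx_of_steps` — the induction from depth `0` (where both averages are the identity, defect `0`): defects
   `δ_k` with `δ_0 = 0`, `Λ_k η_k + δ_k ≤ δ_{k+1}`, i.e. `δ_k ≥ Σ_{j<k} Λ_j η_j`.
 * §3 THE (43) INSTANCES (kernel facts, no hypothesis): `fineGaugeCov_step42` — the `k`-fold (43)-average is covariant under EVERY units-valued gauge with `r = uLev L · k`
   (`B7Prop6Flat.avgIter_gaugeAct_units`, [Balaban1985Averaging] (11) for (43) unconditionally; `uLev` keeps unitarity and turns `(N·L^k)`-periods into `N`-periods);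
   `cov_step42` — the block-lift clause of part 27∕14 for (43) at every depth (`uLev_blockLift`); ★★★ `approx_step42_target_of_steps` — the induction run with (43) AS THE
   TARGET scheme (the orientation that uses (43)'s structure; part 27's `.symm` flips it back): for ANY scheme `s`, (H1) against (43) at every depth follows from the one-step
   defects `η_j`, LIPSCHITZ CONTROL OF THE `j`-FOLD (43)-AVERAGE (the one remaining analytic input on the (43) side, displayed), class propagation + the block-lift clause of `s`,
   and gauge invariance of the classes — (43)'s fine covariance and block-lift clause being discharged here.
READING (honest; for the planners, D-0014).  With parts 27∕28: THE (42)→(0.4) PIN FOR N16's END (A) = per-step defects `η_j` of `step04` against (43) up to fine unitary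
gauges (parts 22∕25∕26: second order, in a local exponential gauge on the guard — their conversion to `StepNear`'s bondwise form is NOT done here) + Lipschitz constants `Λ_j`
of the `j`-fold (43)-average near the class ([Balaban1985Averaging] Prop. 1-type, not in the tree as such) + class propagation and block-lift covariance of `step04` +
right-inverse moduli `ω_k = O(θ^k N^d)` absorbing `δ_k = Σ_{j<k} Λ_j η_j`.  Whether `δ_k` is summable∕geometric is analysis (the `η_j` carry the scale factors), not
bookkeeping.  HONEST SCOPE (self-refereed, g9): sup-norm Lipschitz constants are `≥ 1` (for (43): `Λ_j = 21eL`, parts 30∕31), so `δ_k` from this recursion GROWS unless the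
per-step defects decay faster than `Λ^{−j}` — which the depth-uniform second-order bounds of parts 22∕25∕26 do not give; a depth-uniform closeness needs the CONTRACTION of
averaging on fluctuations ([Balaban1985Averaging] Prop. 2-type decay), not Lipschitz iteration.  And closeness of averages is NOT the mechanism of the END-number pin between two
constraints that differ at unit block scale (their minimal actions have different limits): that input is part 28 §1's geometrically Cauchy discrepancy.  This file is the
bookkeeping of the closeness road, valid for schemes asymptotically equivalent to each other.  Nothing of this is proved for `step04`.

HONEST FRAMING.  [folklore] bookkeeping BY NAME over part 27 and lit-balaban's `B7Prop6Flat.avgIter_gaugeAct_units` ∕ `B7AvgGaugeCovariance.uLev`, g0's `avgIterS`, g6's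
`uLev_blockLift`; three Prop-valued hypothesis SHAPES (`StepNear`, `LipschitzNear`, `FineGaugeCov`) asserted for NO scheme except the (43) covariance instances of §3, which
are unconditional algebra; 0 `sorry`, no `instance`, no `notation`; NO estimate proved; nothing of [Balaban1985Averaging] ∕ [Balaban1985Variational] ∕ [Balaban1987RG1]
asserted; K3⁸ stubs `stub_rates13HV` ∕ `stub_expansion13HV` NOT touched; N16 ∕ NE3 NOT discharged; count-neutral (typed 28∕28 · discharged 5∕27 work-bound, A 5∕28 —
unmoved).  One finite four-torus programme at fixed `ε` — the Yang–Mills mass gap (Clay) is NOT proved by any of this; R4 closes the conditional finite-𝕋⁴ rung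
`BalabanLadder.UV` only; nothing continuum ∕ ℝ⁴ ∕ OS.
-/

set_option autoImplicit false

open scoped BigOperators Matrix Matrix.Norms.L2Operator
open NormedSpace

namespace Summit.QuantumFields.YangMills.BalabanUVNodes.N16ApproximateSchemeTransferSteps

open Literature.MathematicalPhysics.QuantumFieldTheory.Balaban1983to89
open B7Prop1Explicit B7Prop2Explicit
open B7AvgGaugeCovariance (uLev uLev_apply)
open Summit.QuantumFields.BalabanUV.T4Continuum
open NE3EnergyShapes (IsUnitarySite IsPeriodicSite)
open Summit.QuantumFields.YangMills.BalabanUVNodes.N16AveragingPin (avgIterS avgIterS_succ step42 avgIterS_step42)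
open Summit.QuantumFields.YangMills.BalabanUVNodes.N16AveragingTransferOfGaugeDefect (uLev_blockLift)
open Summit.QuantumFields.YangMills.BalabanUVNodes.N16CentreConventionTransfer (gaugeAct_gaugeAct)
open Summit.QuantumFields.YangMills.BalabanUVNodes.N16ApproximateSchemeTransfer
  (CfgNear cfgNear_refl CfgNear.gaugeAct CfgNear.triangle CfgNear.mono ApproxSchemeGaugeEquiv)
open Summit.QuantumFields.YangMills.BalabanUVNodes.N16ApproximateSchemeTransferSub (ApproxSchemeGaugeEquivIn)

noncomputable section

variable {d : ℕ} {n : Type*} [Fintype n] [DecidableEq n]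

/-! ## §1 Hypothesis shapes: one-step defect up to a fine gauge, Lipschitz control, fine gauge covariance -/

section Shapes

variable (d) in
/-- **ONE-STEP DEFECT UP TO A FINE GAUGE AT STEP `k+1`** (depth `k+1 → k`) on a class `C` of depth-`(k+1)` configurations: for every `U ∈ C` the one-step outputs
`s₂ (k+1) U` and `s₁ (k+1) U` (configurations of depth `k`, period `N·L^k`) are bondwise `η`-close up to a `Γ`-valued `(N·L^k)`-periodic gauge of the depth-`k` unit lattice
(`Γ ≤ (M_n ℂ)ˣ` the gauge group: `U(N)`-units, or `SU(N)`-units for the (0.4) side — part 27′).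
A hypothesis SHAPE (what parts 22∕25∕26 measure for ((42), (0.4)) in their own currency); asserted for no pair of schemes. [folklore] -/
@[folklore]
def StepNear (Γ : Subgroup (Matrix n n ℂ)ˣ) (s₁ s₂ : ℕ → (Site d → Fin d → (Matrix n n ℂ)ˣ) → (Site d → Fin d → (Matrix n n ℂ)ˣ)) (L N k : ℕ)
    (C : Set (Site d → Fin d → (Matrix n n ℂ)ˣ)) (η : ℝ) : Prop :=
  ∀ U ∈ C, ∃ κ : Site d → (Matrix n n ℂ)ˣ, (∀ x, κ x ∈ Γ) ∧ IsPeriodicSite κ ((N * L ^ k : ℕ) : ℤ) ∧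
    CfgNear η (s₂ (k + 1) U) (gaugeAct κ (s₁ (k + 1) U))

variable (d) in
/-- **LIPSCHITZ CONTROL OF THE `k`-FOLD `s`-AVERAGE NEAR A CLASS `C`** (competitors from `C₀`, radius `η₀`, constant `Λ`): a configuration of `C₀` bondwise `η`-close
(`η ≤ η₀`) to a member of `C` has its `k`-fold `s`-average bondwise `Λη`-close to the member's (`C₀` = e.g. the `U(N)`-valued configurations: products of unitaries are
`1`-Lipschitz in each factor).  For (43) this is [Balaban1985Averaging] Prop. 1-type control of (42) on the small-field guard composed `k` times — ANALYSIS, located here as a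
hypothesis SHAPE; asserted for no scheme. [folklore] -/
@[folklore]
def LipschitzNear (s : ℕ → (Site d → Fin d → (Matrix n n ℂ)ˣ) → (Site d → Fin d → (Matrix n n ℂ)ˣ)) (k : ℕ)
    (C₀ C : Set (Site d → Fin d → (Matrix n n ℂ)ˣ)) (η₀ Λ : ℝ) : Prop :=
  ∀ (X Y : Site d → Fin d → (Matrix n n ℂ)ˣ), X ∈ C₀ → Y ∈ C → ∀ η : ℝ, 0 ≤ η → η ≤ η₀ → CfgNear η X Y →
    CfgNear (Λ * η) (avgIterS s k X) (avgIterS s k Y)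

variable (d) in
/-- **FINE GAUGE COVARIANCE OF THE `k`-FOLD `s`-AVERAGE ON `C` THROUGH A RESTRICTION MAP `r`** ([Balaban1985Averaging] (11)∕(45) SHAPE «(U^u)‾ = (Ū)^{u|coarse}»): every
`Γ`-valued `(N·L^k)`-periodic gauge `κ` of the depth-`k` unit lattice moves the `k`-fold average by the coarse gauge `r κ`, which is `Γ`-valued and `N`-periodic.  Asserted for
no scheme here except (43) (§3, `r = uLev L · k`, unconditional, every `Γ`). [folklore] -/
@[folklore]
structure FineGaugeCov (Γ : Subgroup (Matrix n n ℂ)ˣ) (s : ℕ → (Site d → Fin d → (Matrix n n ℂ)ˣ) → (Site d → Fin d → (Matrix n n ℂ)ˣ)) (L N k : ℕ)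
    (C : Set (Site d → Fin d → (Matrix n n ℂ)ˣ)) (r : (Site d → (Matrix n n ℂ)ˣ) → (Site d → (Matrix n n ℂ)ˣ)) : Prop where
  /-- the restricted gauge is `Γ`-valued -/
  mem : ∀ κ : Site d → (Matrix n n ℂ)ˣ, (∀ x, κ x ∈ Γ) → ∀ x, r κ x ∈ Γ
  /-- the restricted gauge of an `(N·L^k)`-periodic fine gauge is `N`-periodic -/
  periodic : ∀ κ : Site d → (Matrix n n ℂ)ˣ, IsPeriodicSite κ ((N * L ^ k : ℕ) : ℤ) → IsPeriodicSite (r κ) (N : ℤ)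
  /-- covariance of the `k`-fold average on `C` under `Γ`-valued fine gauges -/
  cov : ∀ (κ : Site d → (Matrix n n ℂ)ˣ) (W : Site d → Fin d → (Matrix n n ℂ)ˣ), (∀ x, κ x ∈ Γ) → IsPeriodicSite κ ((N * L ^ k : ℕ) : ℤ) → W ∈ C →
    avgIterS s k (gaugeAct κ W) = gaugeAct (r κ) (avgIterS s k W)

variable {Γ : Subgroup (Matrix n n ℂ)ˣ} {s₁ s₂ : ℕ → (Site d → Fin d → (Matrix n n ℂ)ˣ) → (Site d → Fin d → (Matrix n n ℂ)ˣ)} {L N k : ℕ}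
  {C C' : Set (Site d → Fin d → (Matrix n n ℂ)ˣ)} {η η' : ℝ}

/-- Monotone in the defect. [folklore] -/
theorem StepNear.mono (h : StepNear d Γ s₁ s₂ L N k C η) (hη : η ≤ η') : StepNear d Γ s₁ s₂ L N k C η' := by
  intro U hU
  obtain ⟨κ, hκ, hκP, hnear⟩ := h U hU
  exact ⟨κ, hκ, hκP, hnear.mono hη⟩

/-- Restricts to sub-classes. [folklore] -/
theorem StepNear.of_subset (h : StepNear d Γ s₁ s₂ L N k C η) (hC' : C' ⊆ C) : StepNear d Γ s₁ s₂ L N k C' η :=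
  fun U hU => h U (hC' hU)

/-- EXACT one-step agreement is the case of every `η ≥ 0` (gauge `1`). [folklore] -/
theorem stepNear_of_eq (hη : 0 ≤ η) (h : ∀ U ∈ C, s₂ (k + 1) U = s₁ (k + 1) U) : StepNear d Γ s₁ s₂ L N k C η := by
  intro U hU
  refine ⟨fun _ => 1, fun _ => Γ.one_mem, fun _ _ => rfl, ?_⟩
  have h1 : gaugeAct (fun _ : Site d => (1 : (Matrix n n ℂ)ˣ)) (s₁ (k + 1) U) = s₁ (k + 1) U := by
    funext x i; simp [gaugeAct]
  rw [h1, h U hU]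
  exact cfgNear_refl hη _

variable {s : ℕ → (Site d → Fin d → (Matrix n n ℂ)ˣ) → (Site d → Fin d → (Matrix n n ℂ)ˣ)} {C₀ C₀' : Set (Site d → Fin d → (Matrix n n ℂ)ˣ)} {η₀ Λ : ℝ} in
/-- Lipschitz control restricts to smaller competitor sets and smaller classes. [folklore] -/
theorem LipschitzNear.anti (h : LipschitzNear d s k C₀ C η₀ Λ) (hC₀ : C₀' ⊆ C₀) (hC' : C' ⊆ C) : LipschitzNear d s k C₀' C' η₀ Λ :=
  fun X Y hX hY η hη hηle hnear => h X Y (hC₀ hX) (hC' hY) η hη hηle hnear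

end Shapes

/-! ## §2 The induction: (H1) at depth `k` + one-step data at step `k+1` ⇒ (H1) at depth `k+1` -/

section Induction

variable {Γ : Subgroup (Matrix n n ℂ)ˣ} (hΓ : Γ ≤ unitaryUnits (Matrix n n ℂ))
  {s₁ s₂ : ℕ → (Site d → Fin d → (Matrix n n ℂ)ˣ) → (Site d → Fin d → (Matrix n n ℂ)ˣ)}
  {𝒞₀ 𝒞 : ℕ → Set (Site d → Fin d → (Matrix n n ℂ)ˣ)} {L N : ℕ} {r : ℕ → (Site d → (Matrix n n ℂ)ˣ) → (Site d → (Matrix n n ℂ)ˣ)}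

/-- **AT DEPTH `0` BOTH AVERAGES ARE THE IDENTITY**: (H1) holds with defect `0` on any class (gauge `1`; the block lift at scale `L^0 = 1` is the gauge itself). [folklore] -/
theorem approx_depth_zero (C : Set (Site d → Fin d → (Matrix n n ℂ)ˣ)) : ApproxSchemeGaugeEquivIn d Γ s₁ s₂ L N 0 C 0 where
  cov₁ κ U _ _ _ := by
    show gaugeAct (fun x : Site d => κ (fun i => x i / (L : ℤ) ^ 0)) U = gaugeAct κ U
    simp only [pow_zero, Int.ediv_one]
  cov₂ κ U _ _ _ := by
    show gaugeAct (fun x : Site d => κ (fun i => x i / (L : ℤ) ^ 0)) U = gaugeAct κ U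
    simp only [pow_zero, Int.ediv_one]
  defect U _ := by
    refine ⟨fun _ => 1, fun _ => Γ.one_mem, fun _ _ => rfl, ?_⟩
    have h1 : gaugeAct (fun _ : Site d => (1 : (Matrix n n ℂ)ˣ)) (avgIterS s₁ 0 U) = avgIterS s₁ 0 U := by
      funext x i; simp [gaugeAct]
    rw [h1]
    exact cfgNear_refl le_rfl _

include hΓ

/-- **★★★ THE INDUCTION STEP.**  Inputs at depth `k` ∕ step `k+1`: (H1) on `𝒞 k` with defect `δ`; `StepNear` at step `k+1` on `𝒞 (k+1)` with `0 ≤ η ≤ η₀`; for the TARGET scheme `s₂`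
at depth `k`: `LipschitzNear` (competitors `𝒞₀ k`, radius `η₀`, constant `Λ`) near `𝒞 k` and `FineGaugeCov` on `𝒞 k` through `r k`; `s₁ (k+1)` maps `𝒞 (k+1)` into `𝒞 k` and
`s₂ (k+1)` into `𝒞₀ k`; `𝒞 k` is invariant under
unitary `(N·L^k)`-periodic gauges; and the two block-lift covariance clauses at depth `k+1` on `𝒞 (k+1)` (structural, per scheme).  Output: (H1) at depth `k+1` on `𝒞 (k+1)`
with defect `Λ·η + δ`.  Chain: `avgIterS s₂ (k+1) U = avgIterS s₂ k (s₂ (k+1) U)` ≈_{Λη} `avgIterS s₂ k (κ·s₁ (k+1) U) = (r κ)·avgIterS s₂ k (s₁ (k+1) U)` ≈_{δ}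
`(r κ)·κ′·avgIterS s₁ k (s₁ (k+1) U) = (r κ·κ′)·avgIterS s₁ (k+1) U`. [folklore] -/
theorem approx_succ {k : ℕ} {δ η η₀ Λ : ℝ}
    (IH : ApproxSchemeGaugeEquivIn d Γ s₁ s₂ L N k (𝒞 k) δ)
    (hstep : StepNear d Γ s₁ s₂ L N k (𝒞 (k + 1)) η) (hη0 : 0 ≤ η) (hηle : η ≤ η₀)
    (hLip : LipschitzNear d s₂ k (𝒞₀ k) (𝒞 k) η₀ Λ) (hcov : FineGaugeCov d Γ s₂ L N k (𝒞 k) (r k))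
    (hmap : ∀ U ∈ 𝒞 (k + 1), s₁ (k + 1) U ∈ 𝒞 k) (hmap₂ : ∀ U ∈ 𝒞 (k + 1), s₂ (k + 1) U ∈ 𝒞₀ k)
    (hCk : ∀ (u : Site d → (Matrix n n ℂ)ˣ) (W : Site d → Fin d → (Matrix n n ℂ)ˣ), (∀ x, u x ∈ Γ) →
      IsPeriodicSite u ((N * L ^ k : ℕ) : ℤ) → W ∈ 𝒞 k → gaugeAct u W ∈ 𝒞 k)
    (cov₁ : ∀ (κ : Site d → (Matrix n n ℂ)ˣ) (U : Site d → Fin d → (Matrix n n ℂ)ˣ), (∀ x, κ x ∈ Γ) → IsPeriodicSite κ (N : ℤ) → U ∈ 𝒞 (k + 1) →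
      avgIterS s₁ (k + 1) (gaugeAct (fun x : Site d => κ (fun i => x i / (L : ℤ) ^ (k + 1))) U) = gaugeAct κ (avgIterS s₁ (k + 1) U))
    (cov₂ : ∀ (κ : Site d → (Matrix n n ℂ)ˣ) (U : Site d → Fin d → (Matrix n n ℂ)ˣ), (∀ x, κ x ∈ Γ) → IsPeriodicSite κ (N : ℤ) → U ∈ 𝒞 (k + 1) →
      avgIterS s₂ (k + 1) (gaugeAct (fun x : Site d => κ (fun i => x i / (L : ℤ) ^ (k + 1))) U) = gaugeAct κ (avgIterS s₂ (k + 1) U)) :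
    ApproxSchemeGaugeEquivIn d Γ s₁ s₂ L N (k + 1) (𝒞 (k + 1)) (Λ * η + δ) where
  cov₁ := cov₁
  cov₂ := cov₂
  defect U hU := by
    obtain ⟨κ, hκ, hκP, hnear⟩ := hstep U hU
    have hW : s₁ (k + 1) U ∈ 𝒞 k := hmap U hU
    have hY : gaugeAct κ (s₁ (k + 1) U) ∈ 𝒞 k := hCk κ _ hκ hκP hW
    -- Lipschitz transport of the one-step defect through the remaining `k` steps of `s₂`
    have h1 : CfgNear (Λ * η) (avgIterS s₂ k (s₂ (k + 1) U)) (avgIterS s₂ k (gaugeAct κ (s₁ (k + 1) U))) :=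
      hLip _ _ (hmap₂ U hU) hY η hη0 hηle hnear
    -- fine gauge covariance of `s₂` at depth `k`
    rw [hcov.cov κ _ hκ hκP hW] at h1
    -- the depth-`k` defect at `W = s₁ (k+1) U`, transported by the unitary coarse gauge `r κ`
    obtain ⟨κ', hκ', hκ'P, hIH⟩ := IH.defect _ hW
    have h2 : CfgNear δ (gaugeAct (r k κ) (avgIterS s₂ k (s₁ (k + 1) U)))
        (gaugeAct (fun z => r k κ z * κ' z) (avgIterS s₁ k (s₁ (k + 1) U))) := by
      rw [← gaugeAct_gaugeAct]
      exact hIH.gaugeAct fun x => hΓ (hcov.mem κ hκ x)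
    refine ⟨fun z => r k κ z * κ' z, fun z => Γ.mul_mem (hcov.mem κ hκ z) (hκ' z), fun z i => ?_, ?_⟩
    · show r k κ (z + (N : ℤ) • e i) * κ' (z + (N : ℤ) • e i) = r k κ z * κ' z
      rw [hcov.periodic κ hκP z i, hκ'P z i]
    · rw [avgIterS_succ, avgIterS_succ]
      exact h1.triangle h2

/-- **★★ PER-STEP ⇒ `k`-FOLD.**  Given, at every step `j+1 ≤ k`: one-step defects `η j` (`0 ≤ η j ≤ η₀ j`) up to fine gauges on `𝒞 (j+1)`, Lipschitz control (radius `η₀ j`,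
constant `Λ j`, competitors `𝒞₀ j`) and fine gauge covariance (`r j`) of the target scheme `s₂` at depth `j`, class propagation of `s₁` (into `𝒞 j`) and of `s₂` (into `𝒞₀ j`),
gauge invariance of every `𝒞 j`, and the block-lift
clauses of both schemes at every depth; then (H1) holds at depth `k` on `𝒞 k` with any defect sequence `δ` satisfying `0 ≤ δ 0` and `Λ j · η j + δ j ≤ δ (j+1)` — e.g.
`δ k = Σ_{j<k} Λ j · η j`. [folklore] -/
theorem approx_of_steps {η η₀ Λ δ : ℕ → ℝ}
    (hstep : ∀ j, StepNear d Γ s₁ s₂ L N j (𝒞 (j + 1)) (η j)) (hη0 : ∀ j, 0 ≤ η j) (hηle : ∀ j, η j ≤ η₀ j)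
    (hLip : ∀ j, LipschitzNear d s₂ j (𝒞₀ j) (𝒞 j) (η₀ j) (Λ j)) (hcov : ∀ j, FineGaugeCov d Γ s₂ L N j (𝒞 j) (r j))
    (hmap : ∀ j, ∀ U ∈ 𝒞 (j + 1), s₁ (j + 1) U ∈ 𝒞 j) (hmap₂ : ∀ j, ∀ U ∈ 𝒞 (j + 1), s₂ (j + 1) U ∈ 𝒞₀ j)
    (hC : ∀ (j : ℕ) (u : Site d → (Matrix n n ℂ)ˣ) (W : Site d → Fin d → (Matrix n n ℂ)ˣ), (∀ x, u x ∈ Γ) →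
      IsPeriodicSite u ((N * L ^ j : ℕ) : ℤ) → W ∈ 𝒞 j → gaugeAct u W ∈ 𝒞 j)
    (cov₁ : ∀ (j : ℕ) (κ : Site d → (Matrix n n ℂ)ˣ) (U : Site d → Fin d → (Matrix n n ℂ)ˣ), (∀ x, κ x ∈ Γ) → IsPeriodicSite κ (N : ℤ) → U ∈ 𝒞 j →
      avgIterS s₁ j (gaugeAct (fun x : Site d => κ (fun i => x i / (L : ℤ) ^ j)) U) = gaugeAct κ (avgIterS s₁ j U))
    (cov₂ : ∀ (j : ℕ) (κ : Site d → (Matrix n n ℂ)ˣ) (U : Site d → Fin d → (Matrix n n ℂ)ˣ), (∀ x, κ x ∈ Γ) → IsPeriodicSite κ (N : ℤ) → U ∈ 𝒞 j →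
      avgIterS s₂ j (gaugeAct (fun x : Site d => κ (fun i => x i / (L : ℤ) ^ j)) U) = gaugeAct κ (avgIterS s₂ j U))
    (hδ0 : 0 ≤ δ 0) (hδ : ∀ j, Λ j * η j + δ j ≤ δ (j + 1)) :
    ∀ k : ℕ, ApproxSchemeGaugeEquivIn d Γ s₁ s₂ L N k (𝒞 k) (δ k)
  | 0 => (approx_depth_zero (𝒞 0)).mono hδ0
  | k + 1 => (approx_succ hΓ (approx_of_steps hstep hη0 hηle hLip hcov hmap hmap₂ hC cov₁ cov₂ hδ0 hδ k) (hstep k) (hη0 k) (hηle k) (hLip k) (hcov k)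
      (hmap k) (hmap₂ k) (hC k) (cov₁ (k + 1)) (cov₂ (k + 1))).mono (hδ k)

end Induction

/-! ## §3 The (43) instances: fine gauge covariance through `uLev`, and the block-lift clause, unconditionally -/

section Step42

variable {Γ : Subgroup (Matrix n n ℂ)ˣ} {L N : ℕ}

/-- `uLev` keeps `Γ`-valuedness. [folklore] -/
theorem uLev_mem {κ : Site d → (Matrix n n ℂ)ˣ} (hκ : ∀ x, κ x ∈ Γ) (k : ℕ) : ∀ x, uLev L κ k x ∈ Γ :=
  fun _ => hκ _

/-- `uLev L · k` turns an `(N·L^k)`-period into an `N`-period: `κ(L^k(z + N e_i)) = κ(L^k z + (N L^k) e_i) = κ(L^k z)`. [folklore] -/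
theorem isPeriodicSite_uLev {κ : Site d → (Matrix n n ℂ)ˣ} (k : ℕ) (hκ : IsPeriodicSite κ ((N * L ^ k : ℕ) : ℤ)) :
    IsPeriodicSite (uLev L κ k) (N : ℤ) := by
  intro z i
  simp only [uLev_apply, smul_add, smul_smul]
  have : ((L : ℤ) ^ k * (N : ℤ)) = ((N * L ^ k : ℕ) : ℤ) := by push_cast; ring
  rw [this]
  exact hκ _ i

/-- **★ (43) IS FINE-GAUGE COVARIANT THROUGH `uLev`, UNCONDITIONALLY, FOR EVERY GAUGE GROUP `Γ`** ([Balaban1985Averaging] (11) for (43) and every units-valued gauge: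
lit-balaban's `B7Prop6Flat.avgIter_gaugeAct_units`; g0's dictionary `avgIterS_step42`). [folklore] -/
theorem fineGaugeCov_step42 (k : ℕ) (C : Set (Site d → Fin d → (Matrix n n ℂ)ˣ)) :
    FineGaugeCov d Γ (fun _ => step42 L) L N k C (fun κ => uLev L κ k) where
  mem κ hκ := uLev_mem hκ k
  periodic κ hκP := isPeriodicSite_uLev k hκP
  cov κ W _ _ _ := by
    rw [avgIterS_step42, avgIterS_step42]
    exact B7Prop6Flat.avgIter_gaugeAct_units L κ W k

/-- **(43)'s BLOCK-LIFT CLAUSE AT EVERY DEPTH, UNCONDITIONALLY** (the case `u = lift κ` of (11): `uLev L (lift κ) k = κ`, g6's `uLev_blockLift`). [folklore] -/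
theorem cov_step42 (hL : 1 ≤ L) (k : ℕ) (κ : Site d → (Matrix n n ℂ)ˣ) (U : Site d → Fin d → (Matrix n n ℂ)ˣ) :
    avgIterS (fun _ => step42 (n := n) L) k (gaugeAct (fun x : Site d => κ (fun i => x i / (L : ℤ) ^ k)) U) = gaugeAct κ (avgIterS (fun _ => step42 L) k U) := by
  rw [avgIterS_step42, avgIterS_step42, B7Prop6Flat.avgIter_gaugeAct_units, uLev_blockLift L hL k κ]

variable {s : ℕ → (Site d → Fin d → (Matrix n n ℂ)ˣ) → (Site d → Fin d → (Matrix n n ℂ)ˣ)} {𝒞₀ 𝒞 : ℕ → Set (Site d → Fin d → (Matrix n n ℂ)ˣ)}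

/-- **★★ PER-STEP ⇒ `k`-FOLD AGAINST (43), WITH THE TARGET SCHEME `s`**: the induction of §2 for the pair ((43), `s`) — (43)'s block-lift clause discharged (§3); displayed:
one-step defects `η j` of `s` against (43) up to fine gauges, Lipschitz control (competitors `𝒞₀ j`) + fine gauge covariance + block-lift clause of `s`, class propagation of
(43) into `𝒞 j` (`rescale ∘ bavg`: [Balaban1985Averaging] Prop. 1 for the small-field class — the tree's `MinimalActionSandwich`∕`MinimalActionRate` bookkeeping takes it as the
same kind of input) and of `s` into `𝒞₀ j`, and gauge invariance of the classes. [folklore] -/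
theorem approx_step42_of_steps (hΓ : Γ ≤ unitaryUnits (Matrix n n ℂ)) (hL : 1 ≤ L) {r : ℕ → (Site d → (Matrix n n ℂ)ˣ) → (Site d → (Matrix n n ℂ)ˣ)}
    {η η₀ Λ δ : ℕ → ℝ}
    (hstep : ∀ j, StepNear d Γ (fun _ => step42 L) s L N j (𝒞 (j + 1)) (η j)) (hη0 : ∀ j, 0 ≤ η j) (hηle : ∀ j, η j ≤ η₀ j)
    (hLip : ∀ j, LipschitzNear d s j (𝒞₀ j) (𝒞 j) (η₀ j) (Λ j)) (hcov : ∀ j, FineGaugeCov d Γ s L N j (𝒞 j) (r j))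
    (hmap : ∀ j, ∀ U ∈ 𝒞 (j + 1), step42 L U ∈ 𝒞 j) (hmap₂ : ∀ j, ∀ U ∈ 𝒞 (j + 1), s (j + 1) U ∈ 𝒞₀ j)
    (hC : ∀ (j : ℕ) (u : Site d → (Matrix n n ℂ)ˣ) (W : Site d → Fin d → (Matrix n n ℂ)ˣ), (∀ x, u x ∈ Γ) →
      IsPeriodicSite u ((N * L ^ j : ℕ) : ℤ) → W ∈ 𝒞 j → gaugeAct u W ∈ 𝒞 j)
    (cov₂ : ∀ (j : ℕ) (κ : Site d → (Matrix n n ℂ)ˣ) (U : Site d → Fin d → (Matrix n n ℂ)ˣ), (∀ x, κ x ∈ Γ) → IsPeriodicSite κ (N : ℤ) → U ∈ 𝒞 j →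
      avgIterS s j (gaugeAct (fun x : Site d => κ (fun i => x i / (L : ℤ) ^ j)) U) = gaugeAct κ (avgIterS s j U))
    (hδ0 : 0 ≤ δ 0) (hδ : ∀ j, Λ j * η j + δ j ≤ δ (j + 1)) (k : ℕ) :
    ApproxSchemeGaugeEquivIn d Γ (fun _ => step42 L) s L N k (𝒞 k) (δ k) :=
  approx_of_steps hΓ hstep hη0 hηle hLip hcov (fun j U hU => hmap j U hU) hmap₂ hC (fun j κ U _ _ _ => cov_step42 hL j κ U) cov₂ hδ0 hδ k

/-- **★★★ PER-STEP ⇒ `k`-FOLD WITH (43) AS THE TARGET SCHEME** (the orientation that uses (43)'s structure): for ANY scheme `s`, (H1) `ApproxSchemeGaugeEquivIn d Γ s (step42 L) L N k (𝒞 k) (δ k)`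
at every depth — hence, by part 27′'s `.symm`, also with the roles swapped — follows from: one-step defects `η j` of (43) against `s` up to fine gauges on `𝒞 (j+1)` (`StepNear d s (step42 L)`),
LIPSCHITZ CONTROL OF THE `j`-FOLD (43)-AVERAGE near `𝒞 j` for competitors in `𝒞₀ j` (radius `η₀ j ≥ η j`, constant `Λ j` — [Balaban1985Averaging] Prop. 1-type analysis of (42),
the ONE remaining analytic input on the (43) side, displayed), class propagation of (43) into `𝒞₀ j` and of `s` into `𝒞 j`, the block-lift clause of `s`, and gauge invariance
of the classes; (43)'s fine gauge covariance (`uLev`) and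
block-lift clause are DISCHARGED (§3).  Defects: any `δ` with `0 ≤ δ 0`, `Λ j · η j + δ j ≤ δ (j+1)`. [folklore] -/
theorem approx_step42_target_of_steps (hΓ : Γ ≤ unitaryUnits (Matrix n n ℂ)) (hL : 1 ≤ L) {η η₀ Λ δ : ℕ → ℝ}
    (hstep : ∀ j, StepNear d Γ s (fun _ => step42 L) L N j (𝒞 (j + 1)) (η j)) (hη0 : ∀ j, 0 ≤ η j) (hηle : ∀ j, η j ≤ η₀ j)
    (hLip : ∀ j, LipschitzNear d (fun _ => step42 (n := n) L) j (𝒞₀ j) (𝒞 j) (η₀ j) (Λ j))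
    (hmap : ∀ j, ∀ U ∈ 𝒞 (j + 1), s (j + 1) U ∈ 𝒞 j) (hmap₂ : ∀ j, ∀ U ∈ 𝒞 (j + 1), step42 L U ∈ 𝒞₀ j)
    (hC : ∀ (j : ℕ) (u : Site d → (Matrix n n ℂ)ˣ) (W : Site d → Fin d → (Matrix n n ℂ)ˣ), (∀ x, u x ∈ Γ) →
      IsPeriodicSite u ((N * L ^ j : ℕ) : ℤ) → W ∈ 𝒞 j → gaugeAct u W ∈ 𝒞 j)
    (cov₁ : ∀ (j : ℕ) (κ : Site d → (Matrix n n ℂ)ˣ) (U : Site d → Fin d → (Matrix n n ℂ)ˣ), (∀ x, κ x ∈ Γ) → IsPeriodicSite κ (N : ℤ) → U ∈ 𝒞 j →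
      avgIterS s j (gaugeAct (fun x : Site d => κ (fun i => x i / (L : ℤ) ^ j)) U) = gaugeAct κ (avgIterS s j U))
    (hδ0 : 0 ≤ δ 0) (hδ : ∀ j, Λ j * η j + δ j ≤ δ (j + 1)) (k : ℕ) :
    ApproxSchemeGaugeEquivIn d Γ s (fun _ => step42 L) L N k (𝒞 k) (δ k) :=
  approx_of_steps (r := fun j κ => uLev L κ j) hΓ hstep hη0 hηle hLip (fun j => fineGaugeCov_step42 j (𝒞 j)) hmap (fun j U hU => hmap₂ j U hU) hC cov₁
    (fun j κ U _ _ _ => cov_step42 hL j κ U) hδ0 hδ k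

end Step42

end

end Summit.QuantumFields.YangMills.BalabanUVNodes.N16ApproximateSchemeTransferSteps
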